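import Summits.RiemannHypothesis.RiemannHypothesis.Theorems.SignConeConeMagnificationKernel

/-!
# `SignCone.ConeMagnification`, line `Sketch`: the registered stub `stub_continuation`
(crux stmt-RiemannHypothesis-16303; HELPER file, `--supports`, proves the stub BY NAME AND SIGNATURE)

`stub_continuation` of the crux skeleton `Cruxes/ConeMagnification/Lines/Sketch.lean`: from the bounded discrepancy
of `stub_fakePNT` (for every Weil test `g`, `‖Σₙ c(n) n^{-1/2}(G(x + log n) + G(x - log n)) - e^{x/2} M_G(0) -
e^{-x/2} M_G(1)‖ ≤ C_g` for all `x`) and `Σ c(n) n^{-σ} < ∞` (`σ > 1`): for every `s₀` with `Re s₀ > 1/2` a function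
`F` holomorphic on the rectangle `(1/2, Re s₀ + 1) × (Im s₀ - η, Im s₀ + η)` with `F = L_c - 1/(s-1)` on its part
`Re s > 1`. Proof from the tree's continuation machinery (`SignConeConeMagnification{Laplace,Series,Kernel}.lean`):

* `LSeries_mul_weilMellin_sub_pole_eq_of_bound`, `differentiableOn_contRHS_of_bound` — the identity
  `L_c(z + 1/2) M_G(z + 1/2) - M_G(1)/(z - 1/2) = ∫₀^∞ u(x) e^{-zx} dx - Fin(z)` and the holomorphy of its right side
  on `Re z > 0`, with the bound on `u(x) = P_c(G(· - x)) - e^{x/2} M_G(1)` as an ABSTRACT hypothesis (the versions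
  in `…Kernel.lean` derive the bound from unit slack; the stub's bounded discrepancy gives it directly, `x ↦ -x`);
* `exists_rect_weilMellin_ne_zero` — a Weil test whose autocorrelation transform has no zero on a thin rectangle
  about a horizontal segment (`exists_isWeilTest_re_weilMellin_pos`);
* `stub_continuation` — divide `H(s) = L_c(s) M_G(s) - M_G(1)/(s-1)` minus the entire `dslope M_G 1` by `M_G`;
  the identity holds at EVERY `s` with `Re s > 1` since `Σ c(n) n^{-Re s} < ∞` there.
-/

noncomputable section

-- `Summit.RiemannHypothesis.RiemannHypothesis.…` repeats a namespace component by design (D-0017 layout).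
set_option linter.dupNamespace false

open scoped BigOperators ComplexConjugate Real
open Complex MeasureTheory Set Filter Metric Topology LSeries

namespace Summit.RiemannHypothesis.RiemannHypothesis.Cruxes.ConeMagnification.Sketch

open Literature.NumberTheory.LFunctions
open Summit.RiemannHypothesis.RiemannHypothesis.Theorems.SignCone

variable {g : ℝ → ℂ} {a : ℝ} {c : ℕ → ℝ}

/-! ## The continuation identity with an abstract translate bound -/

/-- **The continuation identity, abstract-bound form.** Let `c ≥ 0`, `g` a Weil test with `u` bounded by `B` on `x ≥ 0`,
with `tsupport g ⊆ [-a, a]` (`a ≥ 0`), `G = g ⋆ g̃`. For `Re z > 1/2` with `Σ c(n) n^{-(Re z + 1/2)} < ∞`: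
`D_c(z + 1/2) M_G(z + 1/2) - M_G(1)/(z - 1/2) = ∫₀^∞ u(x) e^{-zx} dx - Fin(z)`, where
`u(x) = P_c(G(· - x)) - e^{x/2} M_G(1)` and `Fin` is the finite correction of `LSeries_mul_transform_eq`
(`N₀ = ⌊e^{2a}⌋ + 1` terms). [folklore] -/
theorem LSeries_mul_weilMellin_sub_pole_eq_of_bound
    {B : ℝ} (hBd : ∀ x : ℝ, 0 ≤ x → ‖(∑' n : ℕ, ((c n : ℝ) : ℂ) / (Real.sqrt n : ℂ) *
        (weilConv g (weilReflect g) (Real.log n - x) + weilConv g (weilReflect g) (-Real.log n - x))) -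
        cexp ((x : ℂ) / 2) * weilMellin (weilConv g (weilReflect g)) 1‖ ≤ B)
    (hc : ∀ n, 0 ≤ c n) (hg : IsWeilTest g) (ha : 0 ≤ a) (hsupp : tsupport g ⊆ Icc (-a) a)
    {z : ℂ} (hz : 1 / 2 < z.re)
    (hsum : LSeriesSummable (fun n => ((c n : ℝ) : ℂ)) ((z.re + 1 / 2 : ℝ) : ℂ)) :
    LSeries (fun n => ((c n : ℝ) : ℂ)) (z + 1 / 2) * weilMellin (weilConv g (weilReflect g)) (z + 1 / 2) -
        weilMellin (weilConv g (weilReflect g)) 1 / (z - 1 / 2) =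
      (∫ x in Ioi (0 : ℝ), ((∑' n : ℕ, ((c n : ℝ) : ℂ) / (Real.sqrt n : ℂ) *
        (weilConv g (weilReflect g) (Real.log n - x) + weilConv g (weilReflect g) (-Real.log n - x))) -
          cexp ((x : ℂ) / 2) * weilMellin (weilConv g (weilReflect g)) 1) * cexp (-(z * x))) -
      ∑ n ∈ Finset.range (⌊Real.exp (2 * a)⌋₊ + 1), ((c n : ℝ) : ℂ) / (Real.sqrt n : ℂ) *
        ((∫ x in Ioi (0 : ℝ), (weilConv g (weilReflect g) (Real.log n - x) +
            weilConv g (weilReflect g) (-Real.log n - x)) * cexp (-(z * x))) -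
          cexp (-(z * Real.log n)) * weilMellin (weilConv g (weilReflect g)) (z + 1 / 2)) := by
  set G := weilConv g (weilReflect g) with hG
  have hGt : IsWeilTest G := hg.weilConv hg.weilReflect
  have hGs : ∀ v : ℝ, 2 * a ≤ |v| → G v = 0 := fun v hv =>
    Literature.NumberTheory.LFunctions.weilConv_weilReflect_eq_zero_of_le_abs hg hsupp hv
  obtain ⟨M, hM⟩ := hGt.1.continuous.bounded_above_of_compact_support hGt.2
  have hz0 : 0 ≤ z.re := by linarith
  have hz0' : 0 < z.re := by linarith
  have hmain := LSeries_mul_transform_eq hGt.1.continuous hGs (by linarith) hM hc hz0 hsum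
  rw [integral_mul_exp_eq_weilMellin] at hmain
  -- split `P = u + e^{x/2} M_G(1)` inside the Laplace integral
  set u : ℝ → ℂ := fun x => (∑' n : ℕ, ((c n : ℝ) : ℂ) / (Real.sqrt n : ℂ) *
      (G (Real.log n - x) + G (-Real.log n - x))) - cexp ((x : ℂ) / 2) * weilMellin G 1 with hu
  have hB : ∀ x : ℝ, 0 ≤ x → ‖u x‖ ≤ B := fun x hx => hBd x hx
  have huc : Continuous u := @continuous_fakeSum_translate_sub g a hg hsupp c
  have hui : IntegrableOn (fun x : ℝ => u x * cexp (-(z * x))) (Ioi 0) :=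
    integrableOn_mul_exp_of_bounded huc hB hz0'
  have hei : IntegrableOn (fun x : ℝ => cexp ((x : ℂ) / 2) * weilMellin G 1 * cexp (-(z * x))) (Ioi 0) := by
    have ha' : ((1 / 2 : ℂ) - z).re < 0 := by
      simp only [sub_re, one_div]
      norm_num
      linarith
    have h : IntegrableOn (fun x : ℝ => cexp ((1 / 2 - z) * x) * weilMellin G 1) (Ioi 0) :=
      (integrableOn_exp_mul_complex_Ioi ha' 0).mul_const _
    refine h.congr_fun (fun x _ => ?_) measurableSet_Ioi
    show cexp ((1 / 2 - z) * x) * weilMellin G 1 = cexp ((x : ℂ) / 2) * weilMellin G 1 * cexp (-(z * x))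
    rw [show ((1 / 2 : ℂ) - z) * x = (x : ℂ) / 2 + -(z * x) by ring, Complex.exp_add]
    ring
  have hsplit : (∫ x in Ioi (0 : ℝ), (∑' n : ℕ, ((c n : ℝ) : ℂ) / (Real.sqrt n : ℂ) *
      (G (Real.log n - x) + G (-Real.log n - x))) * cexp (-(z * x))) =
      (∫ x in Ioi (0 : ℝ), u x * cexp (-(z * x))) + weilMellin G 1 / (z - 1 / 2) := by
    have e : (fun x : ℝ => (∑' n : ℕ, ((c n : ℝ) : ℂ) / (Real.sqrt n : ℂ) *
        (G (Real.log n - x) + G (-Real.log n - x))) * cexp (-(z * x))) =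
        fun x : ℝ => u x * cexp (-(z * x)) + cexp ((x : ℂ) / 2) * weilMellin G 1 * cexp (-(z * x)) := by
      funext x; simp only [hu]; ring
    rw [e, integral_add hui hei]
    congr 1
    have e2 : (fun x : ℝ => cexp ((x : ℂ) / 2) * weilMellin G 1 * cexp (-(z * x))) =
        fun x : ℝ => weilMellin G 1 * (cexp ((x : ℂ) / 2) * cexp (-(z * x))) := by
      funext x; ring
    rw [e2, integral_const_mul, integral_exp_half_laplace hz]
    ring
  rw [hsplit] at hmain
  show LSeries (fun n => ((c n : ℝ) : ℂ)) (z + 1 / 2) * weilMellin G (z + 1 / 2) - weilMellin G 1 / (z - 1 / 2) =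
    (∫ x in Ioi (0 : ℝ), u x * cexp (-(z * x))) -
      ∑ n ∈ Finset.range (⌊Real.exp (2 * a)⌋₊ + 1), ((c n : ℝ) : ℂ) / (Real.sqrt n : ℂ) *
        ((∫ x in Ioi (0 : ℝ), (G (Real.log n - x) + G (-Real.log n - x)) * cexp (-(z * x))) -
          cexp (-(z * Real.log n)) * weilMellin G (z + 1 / 2))
  rw [sub_eq_iff_eq_add, hmain]
  ring

/-- **The right-hand side is holomorphic on `Re z > 0`** (abstract-bound form). [folklore] -/
theorem differentiableOn_contRHS_of_bound
    {B : ℝ} (hBd : ∀ x : ℝ, 0 ≤ x → ‖(∑' n : ℕ, ((c n : ℝ) : ℂ) / (Real.sqrt n : ℂ) *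
        (weilConv g (weilReflect g) (Real.log n - x) + weilConv g (weilReflect g) (-Real.log n - x))) -
        cexp ((x : ℂ) / 2) * weilMellin (weilConv g (weilReflect g)) 1‖ ≤ B)
    (hg : IsWeilTest g) (hsupp : tsupport g ⊆ Icc (-a) a) (N : ℕ) :
    DifferentiableOn ℂ (fun z : ℂ =>
      (∫ x in Ioi (0 : ℝ), ((∑' n : ℕ, ((c n : ℝ) : ℂ) / (Real.sqrt n : ℂ) *
        (weilConv g (weilReflect g) (Real.log n - x) + weilConv g (weilReflect g) (-Real.log n - x))) -
          cexp ((x : ℂ) / 2) * weilMellin (weilConv g (weilReflect g)) 1) * cexp (-(z * x))) -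
      ∑ n ∈ Finset.range N, ((c n : ℝ) : ℂ) / (Real.sqrt n : ℂ) *
        ((∫ x in Ioi (0 : ℝ), (weilConv g (weilReflect g) (Real.log n - x) +
            weilConv g (weilReflect g) (-Real.log n - x)) * cexp (-(z * x))) -
          cexp (-(z * Real.log n)) * weilMellin (weilConv g (weilReflect g)) (z + 1 / 2)))
      {z : ℂ | 0 < z.re} := by
  set G := weilConv g (weilReflect g) with hG
  have hGt : IsWeilTest G := hg.weilConv hg.weilReflect
  have hGs : ∀ v : ℝ, 2 * a ≤ |v| → G v = 0 := fun v hv =>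
    Literature.NumberTheory.LFunctions.weilConv_weilReflect_eq_zero_of_le_abs hg hsupp hv
  obtain ⟨M, hM⟩ := hGt.1.continuous.bounded_above_of_compact_support hGt.2
  have hMG : Differentiable ℂ (fun z : ℂ => weilMellin G (z + 1 / 2)) :=
    (differentiable_weilMellin hGt.1.continuous hGt.2).comp (differentiable_id.add_const _)
  have hFin := differentiableOn_finCorrection hGt.1.continuous hGs hM c N
    (by simp_rw [integral_mul_exp_eq_weilMellin]; exact hMG.differentiableOn)
  simp_rw [integral_mul_exp_eq_weilMellin] at hFin
  refine DifferentiableOn.sub ?_ hFin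
  exact differentiableOn_laplace (@continuous_fakeSum_translate_sub g a hg hsupp c) hBd

/-! ## Windows and zero-free rectangles -/

/-- A Weil test has a window: `tsupport g ⊆ [-a, a]` for some `a > 0`. [folklore] -/
theorem exists_window_of_isWeilTest {g : ℝ → ℂ} (hg : IsWeilTest g) :
    ∃ a : ℝ, 0 < a ∧ tsupport g ⊆ Icc (-a) a := by
  obtain ⟨R, hR⟩ := hg.2.isCompact.isBounded.subset_closedBall 0
  refine ⟨max R 1, lt_of_lt_of_le one_pos (le_max_right _ _), fun t ht => ?_⟩
  have h' := hR ht
  rw [Metric.mem_closedBall, dist_zero_right, Real.norm_eq_abs] at h'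
  have hRa : R ≤ max R 1 := le_max_left _ _
  exact ⟨by linarith [neg_abs_le t], by linarith [le_abs_self t]⟩

/-- For every height `γ` and every `X` there are a Weil test `g` and `δ > 0` such that
`M_{g ⋆ g̃}(s) = ĝ(s) · conj ĝ(1 - s̄) ≠ 0` whenever `-1 ≤ Re s ≤ X + 1` and `|Im s - γ| < δ` (a narrow bump has
`Re ĝ > 0` on the whole line `Im s = γ`, `exists_isWeilTest_re_weilMellin_pos`; the zero-free set is open and
contains the compact segment). [folklore] -/
theorem exists_rect_weilMellin_ne_zero (γ X : ℝ) :
    ∃ g : ℝ → ℂ, IsWeilTest g ∧ ∃ δ : ℝ, 0 < δ ∧ ∀ s : ℂ, -1 ≤ s.re → s.re ≤ X + 1 → |s.im - γ| < δ →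
      weilMellin (weilConv g (weilReflect g)) s ≠ 0 := by
  obtain ⟨g, hg, hposg⟩ := exists_isWeilTest_re_weilMellin_pos γ
  refine ⟨g, hg, ?_⟩
  set MG : ℂ → ℂ := weilMellin (weilConv g (weilReflect g)) with hMG
  have hline : ∀ σ : ℝ, MG ((σ : ℂ) + γ * I) ≠ 0 := by
    intro σ
    rw [hMG, weilMellin_weilQuadratic hg]
    have h1 : weilMellin g ((σ : ℂ) + γ * I) ≠ 0 := fun h0 => by
      have := hposg σ; rw [h0, Complex.zero_re] at this; exact lt_irrefl _ this
    have h2 : weilMellin g (1 - conj ((σ : ℂ) + γ * I)) ≠ 0 := fun h0 => by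
      have := hposg (1 - σ)
      rw [show (((1 - σ : ℝ)) : ℂ) + γ * I = 1 - conj ((σ : ℂ) + γ * I) from ?_, h0, Complex.zero_re] at this
      · exact lt_irrefl _ this
      · apply Complex.ext <;> simp
    exact mul_ne_zero h1 ((map_ne_zero _).2 h2)
  have hcont : Continuous MG :=
    (differentiable_weilMellin (hg.weilConv hg.weilReflect).1.continuous (hg.weilConv hg.weilReflect).2).continuous
  set K : Set ℂ := (fun σ : ℝ => (σ : ℂ) + γ * I) '' Icc (-1 : ℝ) (X + 1) with hK
  have hKc : IsCompact K := isCompact_Icc.image (by fun_prop)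
  set U : Set ℂ := {s : ℂ | MG s ≠ 0} with hU
  have hUo : IsOpen U := isOpen_ne_fun hcont continuous_const
  have hKU : K ⊆ U := by
    rintro _ ⟨σ, _, rfl⟩
    exact hline σ
  obtain ⟨δ, hδ, hthick⟩ := hKc.exists_thickening_subset_open hUo hKU
  refine ⟨δ, hδ, fun s h1 h2 h3 => ?_⟩
  have hs : s ∈ Metric.thickening δ K := by
    rw [Metric.mem_thickening_iff]
    refine ⟨(s.re : ℂ) + γ * I, ⟨s.re, ⟨h1, h2⟩, rfl⟩, ?_⟩
    rw [Complex.dist_eq, show s - ((s.re : ℂ) + γ * I) = ((s.im - γ : ℝ) : ℂ) * I from ?_, norm_mul,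
      Complex.norm_I, mul_one, Complex.norm_real, Real.norm_eq_abs]
    · exact h3
    · apply Complex.ext <;> simp
  exact hthick hs

/-! ## The stub -/

/-- **Registered stub `stub_continuation` of the line `Sketch`** (bounded discrepancy ⇒ local analytic
continuation of `L_c(s) - 1/(s-1)` to `Re s > 1/2`): see the module docstring. [folklore] -/
theorem stub_continuation : ∀ c : ℕ → ℝ, (∀ n, 0 ≤ c n) → (∀ g : ℝ → ℂ, IsWeilTest g → ∃ C : ℝ, ∀ x : ℝ, ‖(∑' n : ℕ, ((c n : ℝ) : ℂ) / (Real.sqrt n : ℂ) * (weilConv g (weilReflect g) (x + Real.log n) + weilConv g (weilReflect g) (x - Real.log n))) - Complex.exp (x / 2) * weilMellin (weilConv g (weilReflect g)) 0 - Complex.exp (-(x / 2)) * weilMellin (weilConv g (weilReflect g)) 1‖ ≤ C) → (∀ σ : ℝ, 1 < σ → LSeriesSummable (fun n => ((c n : ℝ) : ℂ)) σ) → ∀ s₀ : ℂ, 1 / 2 < s₀.re → ∃ η : ℝ, 0 < η ∧ ∃ F : ℂ → ℂ, DifferentiableOn ℂ F {s : ℂ | 1 / 2 < s.re ∧ s.re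 < s₀.re + 1 ∧ s₀.im - η < s.im ∧ s.im < s₀.im + η} ∧ ∀ s ∈ {s : ℂ | 1 / 2 < s.re ∧ s.re < s₀.re + 1 ∧ s₀.im - η < s.im ∧ s.im < s₀.im + η}, 1 < s.re → F s = LSeries (fun n => ((c n : ℝ) : ℂ)) s - 1 / (s - 1) := by
  intro c hc hPNT hsum s₀ hs₀
  obtain ⟨g, hg, δ, hδ, hne⟩ := exists_rect_weilMellin_ne_zero s₀.im (s₀.re + 1)
  obtain ⟨a, ha, hsupp⟩ := exists_window_of_isWeilTest hg
  set G := weilConv g (weilReflect g) with hG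
  have hGt : IsWeilTest G := hg.weilConv hg.weilReflect
  set MG : ℂ → ℂ := weilMellin G with hMG
  have hMGd : Differentiable ℂ MG := differentiable_weilMellin hGt.1.continuous hGt.2
  -- the bound on `u(x) = P_c(G(· - x)) - e^{x/2} M_G(1)` for `x ≥ 0`, from the discrepancy bound at `-x`
  obtain ⟨C, hC⟩ := hPNT g hg
  have hBd : ∀ x : ℝ, 0 ≤ x → ‖(∑' n : ℕ, ((c n : ℝ) : ℂ) / (Real.sqrt n : ℂ) *
      (G (Real.log n - x) + G (-Real.log n - x))) - cexp ((x : ℂ) / 2) * MG 1‖ ≤ C + ‖MG 0‖ := by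
    intro x hx
    have h := hC (-x)
    have e : (∑' n : ℕ, ((c n : ℝ) : ℂ) / (Real.sqrt n : ℂ) * (G (-x + Real.log n) + G (-x - Real.log n))) =
        ∑' n : ℕ, ((c n : ℝ) : ℂ) / (Real.sqrt n : ℂ) * (G (Real.log n - x) + G (-Real.log n - x)) := by
      refine tsum_congr fun n => ?_
      congr 3 <;> ring
    rw [e] at h
    have e2 : Complex.exp ((-x : ℝ) / 2) = cexp (-((x : ℂ) / 2)) := by push_cast; ring_nf
    have e3 : Complex.exp (-((-x : ℝ) / 2)) = cexp ((x : ℂ) / 2) := by push_cast; ring_nf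
    rw [e2, e3] at h
    have hex : ‖cexp (-((x : ℂ) / 2)) * MG 0‖ ≤ ‖MG 0‖ := by
      rw [norm_mul, Complex.norm_exp]
      have : (-((x : ℂ) / 2)).re = -(x / 2) := by simp
      rw [this]
      exact mul_le_of_le_one_left (norm_nonneg _) (Real.exp_le_one_iff.2 (by linarith))
    calc ‖(∑' n : ℕ, ((c n : ℝ) : ℂ) / (Real.sqrt n : ℂ) * (G (Real.log n - x) + G (-Real.log n - x))) -
          cexp ((x : ℂ) / 2) * MG 1‖
        = ‖((∑' n : ℕ, ((c n : ℝ) : ℂ) / (Real.sqrt n : ℂ) * (G (Real.log n - x) + G (-Real.log n - x))) -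
            cexp (-((x : ℂ) / 2)) * MG 0 - cexp ((x : ℂ) / 2) * MG 1) + cexp (-((x : ℂ) / 2)) * MG 0‖ := by
          congr 1; ring
      _ ≤ _ := (norm_add_le _ _).trans (add_le_add h hex)
  set N : ℕ := ⌊Real.exp (2 * a)⌋₊ + 1 with hN
  set RHS : ℂ → ℂ := fun z : ℂ =>
      (∫ x in Ioi (0 : ℝ), ((∑' n : ℕ, ((c n : ℝ) : ℂ) / (Real.sqrt n : ℂ) *
        (G (Real.log n - x) + G (-Real.log n - x))) - cexp ((x : ℂ) / 2) * MG 1) * cexp (-(z * x))) -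
      ∑ n ∈ Finset.range N, ((c n : ℝ) : ℂ) / (Real.sqrt n : ℂ) *
        ((∫ x in Ioi (0 : ℝ), (G (Real.log n - x) + G (-Real.log n - x)) * cexp (-(z * x))) -
          cexp (-(z * Real.log n)) * MG (z + 1 / 2)) with hRHS
  have hRHSd : DifferentiableOn ℂ RHS {z : ℂ | 0 < z.re} :=
    @differentiableOn_contRHS_of_bound g a c (C + ‖MG 0‖) hBd hg hsupp N
  set H : ℂ → ℂ := fun s => RHS (s - 1 / 2) with hH
  have hHd : DifferentiableOn ℂ H {s : ℂ | 1 / 2 < s.re} := by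
    refine hRHSd.comp (by fun_prop) fun s hs => ?_
    show 0 < (s - 1 / 2).re
    have : 1 / 2 < s.re := hs
    simp; linarith
  have hDs : Differentiable ℂ (dslope MG 1) := by
    intro s
    rcases eq_or_ne s 1 with rfl | hs
    · obtain ⟨p, hp⟩ := hMGd.analyticAt 1
      exact hp.has_fpower_series_dslope_fslope.analyticAt.differentiableAt
    · exact (differentiableAt_dslope_of_ne hs).2 (hMGd s)
  set A : ℂ → ℂ := fun s => (H s - dslope MG 1 s) / MG s with hA
  set Rect : Set ℂ := {s : ℂ | 1 / 2 < s.re ∧ s.re < s₀.re + 1 ∧ s₀.im - δ < s.im ∧ s.im < s₀.im + δ} with hRect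
  have hRne : ∀ s ∈ Rect, MG s ≠ 0 := by
    rintro s ⟨h1, h2, h3, h4⟩
    exact hne s (by linarith) (by linarith) (abs_lt.2 ⟨by linarith, by linarith⟩)
  refine ⟨δ, hδ, A, ?_, ?_⟩
  · refine DifferentiableOn.div ((hHd.mono fun s hs => hs.1).sub hDs.differentiableOn)
      hMGd.differentiableOn hRne
  · rintro s hs hs1
    have hsre : 1 / 2 < (s - 1 / 2).re := by simp; linarith
    have hsum' : LSeriesSummable (fun n => ((c n : ℝ) : ℂ)) (((s - 1 / 2).re + 1 / 2 : ℝ) : ℂ) := by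
      have h := hsum s.re hs1
      have e : (((s - 1 / 2).re + 1 / 2 : ℝ) : ℂ) = (s.re : ℂ) := by
        congr 1; simp
      rw [e]
      exact h
    have hid := @LSeries_mul_weilMellin_sub_pole_eq_of_bound g a c (C + ‖MG 0‖) hBd hc hg ha.le hsupp _ hsre hsum'
    rw [← hG] at hid
    have e1 : s - 1 / 2 + 1 / 2 = s := by ring
    have e2 : s - 1 / 2 - 1 / 2 = s - 1 := by ring
    have hHs : H s = LSeries (fun n => ((c n : ℝ) : ℂ)) s * MG s - MG 1 / (s - 1) := by
      calc H s = RHS (s - 1 / 2) := rfl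
        _ = LSeries (fun n => ((c n : ℝ) : ℂ)) (s - 1 / 2 + 1 / 2) * MG (s - 1 / 2 + 1 / 2) -
              MG 1 / (s - 1 / 2 - 1 / 2) := hid.symm
        _ = _ := by rw [e1, e2]
    have hMs := hRne s hs
    have hs1' : s - 1 ≠ 0 := by
      intro h
      have := congrArg Complex.re h
      simp at this
      linarith
    have hsne : s ≠ 1 := fun h => hs1' (by rw [h, sub_self])
    have hdsl : dslope MG 1 s = (MG s - MG 1) / (s - 1) := by
      rw [dslope_of_ne _ hsne, slope_def_field]
    simp only [hA, hHs, hdsl]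
    field_simp
    ring

end Summit.RiemannHypothesis.RiemannHypothesis.Cruxes.ConeMagnification.Sketch

end
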